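import Mathlib
import Summits.ResolutionOfSingularities.ResolutionOfSingularities.Theorems.WeightedInvariantLocalWeightedDropMonicDescentInvariantLaws
import Summits.ResolutionOfSingularities.ResolutionOfSingularities.Theorems.WeightedInvariantLocalWeightedDropMonicDescentTransportLaws
import HarnessLib

/-!
# `WeightedInvariant.LocalWeightedDrop`, line `hasse-ridge-face-selection`: the scaled polygon invariants of a point set
# `N ⊂ ℕ²` under the chart maps AT A GENERAL SCALE `c` — `psi c` (`u₁`-chart), `phiE c` (`u₂`-chart), coordinate shifts by `c`

Crux item stmt-ResolutionOfSingularities-8899 `LocalWeightedDrop` (route `ResolutionOfSingularities/WeightedInvariant`), serving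
the door `WeightedConstruction` stmt-ResolutionOfSingularities-0571.  [OURS · L1 W4.3, chain w43, support typer res-L1-type-o7
(seat res-D-pv-023): NP-API v1.2 §4 item 2 / offer (o1) — the ENCODING-NEUTRAL COMMON CORE of the Newton-polygon layer at a general
scale.  `…MonicDescentInvariantLaws` (lead-1, N4″) proves these laws at `c = 2` (labels of `y`-degree 2); the S3ρ measure of
res-type-083 / res-D-pv-005 AS stub-7 (`WildMonic.newtonSet d A`, scale `d!`, TAKING 04:54:13Z «the three general-c psi facts I need
(α′ = δ − c, ε′ = ε, δ′ = min(P₀+2P₁) − c)») and the S3πM pure case of stub-1 / stub-6 (scale `(d−1)!·supp A₀`) need them at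
`c = d!`; pure combinatorics on `N ⊂ ℕ²`, no series.  MODEL: Cossart–Jannsen–Saito LNM 2270 Lemma 12.1 (3) / 13.2 (2)
(`u₁`-chart: `α′ = δ − 1`, `β′ = γ⁻ ≤ β`, `ε′ = ε`, `ζ′ = ζ + ε − 1`), Lemma 12.2 / 13.4 (2) (`u₂`-chart: `α′ = α`, `β′ = α + β − 1`),
Lemma 12.4 (curve blow-up: shift), everything × the scale `c`. NOT a statement of any manuscript.]

For `N ⊂ ℕ²` (scaled invariants `deltaL alphaL betaL gammaL epsL zetaL` of `…MonicDescentLabels`; maps `psi c P = (P₀ + P₁ − c, P₁)`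
of `…MonicDescentBlowOneLaws`, `phiE c P = (P₀, P₀ + P₁ − c)` of `…MonicDescentTransportLaws`; standing hypotheses `N ≠ ∅` and, where
a truncated subtraction must be exact, `∀ P ∈ N, c ≤ P₀ + P₁` — the «order ≥ c» of the position):
* `psi c`: `alphaL_image_psiC` (`α′ = δ − c`), `mem_image_psiC_col_iff`, `betaL_image_psiC` (`β′ = γ⁻`), `betaL_image_psiC_le` (`β′ ≤ β`),
  `epsL_image_psiC` (`ε′ = ε`), `zetaL_image_psiC` (`ζ′ = ζ + ε − c`), `deltaL_image_psiC_add` (`δ′ + c = min (P₀ + 2P₁)`),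
  `le_apply_add_of_mem_image_psiC` (the image keeps `P₀ + P₁ ≥ ε′`-type bounds: `Q₀ + 2·Q₁ ≥ …` — stated as what is true:
  `Q ∈ psi c '' N → Q₀ + c = P₀ + P₁` for its preimage);
* `phiE c` (the letter swap of `psi c`): `alphaL_image_phiEC` (`α′ = α`), `betaL_image_phiEC` (`β′ = α + β − c`), `epsL_image_phiEC`
  (`ε′ = δ − c`), `deltaL_image_phiEC_add` (`δ′ + c = min (2P₀ + P₁)`);
* shifts, DEF-FREE (any map `σ` with `σ P 0 + c = P 0`, `σ P 1 = P 1` on `N`, e.g. `shiftOne` at `c = 2` or stub-7's `−(d!, 0)`):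
  `alphaL_image_shift_add` (`α′ + c = α`), `betaL_image_shift` (`β′ = β`), `epsL_image_shift` (`ε′ = ε`), `zetaL_image_shift_add`
  (`ζ′ + c = ζ`), `deltaL_image_shift_add` (`δ′ + c = δ`); and the mirror family for `σ P 0 = P 0`, `σ P 1 + c = P 1`.
[cite: CossartJannsenSaito2020, Lemma 12.1 (3), Lemma 12.2 (3), Lemma 12.4 (4), Def. 11.1] [folklore]
-/

set_option linter.dupNamespace false -- mandated namespace of this single-conjunct summit

namespace Summit.ResolutionOfSingularities.ResolutionOfSingularities.Theorems

namespace MonicDescent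

variable {N : Set (Fin 2 →₀ ℕ)} {c : ℕ}

/-! ## The `u₁`-chart at scale `c`: `N′ = psi c '' N` -/

/-- `α′ = δ − c`. -/
theorem alphaL_image_psiC (c : ℕ) (hN : N.Nonempty) : alphaL (psi c '' N) = deltaL N - c := by
  apply le_antisymm
  · obtain ⟨P, hP, hPd⟩ := exists_eq_deltaL hN
    have h := alphaL_le (N := psi c '' N) ⟨P, hP, rfl⟩
    rw [psi_apply_zero] at h
    omega
  · obtain ⟨Q, ⟨P, hP, rfl⟩, hQ0⟩ := exists_eq_alphaL (hN.image (psi c))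
    rw [← hQ0, psi_apply_zero]
    have := deltaL_le hP
    omega

/-- The leftmost column of `psi c '' N` is the image of the `δ`-face of `N` (order `≥ c`). -/
theorem mem_image_psiC_col_iff (hNc : ∀ P ∈ N, c ≤ P 0 + P 1) (hN : N.Nonempty) (Q : Fin 2 →₀ ℕ) :
    (Q ∈ psi c '' N ∧ Q 0 = alphaL (psi c '' N)) ↔ ∃ P ∈ N, P 0 + P 1 = deltaL N ∧ Q = psi c P := by
  rw [alphaL_image_psiC c hN]
  have hδ : c ≤ deltaL N := by
    obtain ⟨R, hR, hRd⟩ := exists_eq_deltaL hN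
    have := hNc R hR
    omega
  constructor
  · rintro ⟨⟨P, hP, rfl⟩, h0⟩
    rw [psi_apply_zero] at h0
    have := deltaL_le hP
    have := hNc P hP
    exact ⟨P, hP, by omega, rfl⟩
  · rintro ⟨P, hP, hPd, rfl⟩
    refine ⟨⟨P, hP, rfl⟩, ?_⟩
    rw [psi_apply_zero]
    omega

/-- `β′ = γ⁻` (CJS 12.1 (3) at scale `c`). -/
theorem betaL_image_psiC (hNc : ∀ P ∈ N, c ≤ P 0 + P 1) (hN : N.Nonempty) : betaL (psi c '' N) = gammaL N := by
  unfold betaL gammaL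
  congr 1
  ext n
  constructor
  · rintro ⟨Q, hQ, rfl⟩
    obtain ⟨P, hP, hPd, rfl⟩ := (mem_image_psiC_col_iff hNc hN Q).mp hQ
    exact ⟨P, ⟨hP, hPd⟩, (psi_apply_one c P).symm⟩
  · rintro ⟨P, ⟨hP, hPd⟩, rfl⟩
    exact ⟨psi c P, (mem_image_psiC_col_iff hNc hN _).mpr ⟨P, hP, hPd, rfl⟩, psi_apply_one c P⟩

/-- `β′ ≤ β`. -/
theorem betaL_image_psiC_le (hNc : ∀ P ∈ N, c ≤ P 0 + P 1) (hN : N.Nonempty) : betaL (psi c '' N) ≤ betaL N := by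
  rw [betaL_image_psiC hNc hN]
  exact gammaL_le_betaL hN

/-- `ε′ = ε`. -/
theorem epsL_image_psiC (c : ℕ) (N : Set (Fin 2 →₀ ℕ)) : epsL (psi c '' N) = epsL N := by
  unfold epsL
  congr 1
  ext n
  constructor
  · rintro ⟨Q, ⟨P, hP, rfl⟩, rfl⟩
    exact ⟨P, hP, (psi_apply_one c P).symm⟩
  · rintro ⟨P, hP, rfl⟩
    exact ⟨psi c P, ⟨P, hP, rfl⟩, psi_apply_one c P⟩

/-- `ζ′ = ζ + ε − c`. -/
theorem zetaL_image_psiC (hNc : ∀ P ∈ N, c ≤ P 0 + P 1) (hN : N.Nonempty) :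
    zetaL (psi c '' N) = zetaL N + epsL N - c := by
  have hrow : ∀ Q, (Q ∈ psi c '' N ∧ Q 1 = epsL (psi c '' N)) ↔ ∃ P ∈ N, P 1 = epsL N ∧ Q = psi c P := by
    intro Q
    rw [epsL_image_psiC]
    constructor
    · rintro ⟨⟨P, hP, rfl⟩, h1⟩
      rw [psi_apply_one] at h1
      exact ⟨P, hP, h1, rfl⟩
    · rintro ⟨P, hP, hP1, rfl⟩
      exact ⟨⟨P, hP, rfl⟩, by rw [psi_apply_one]; exact hP1⟩
  apply le_antisymm
  · obtain ⟨P, hP, hP1, hP0⟩ := exists_eq_zetaL hN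
    have h := zetaL_le (N := psi c '' N) (P := psi c P) ⟨P, hP, rfl⟩ (by rw [psi_apply_one, epsL_image_psiC]; exact hP1)
    rw [psi_apply_zero] at h
    omega
  · obtain ⟨Q, hQ, hQ1, hQ0⟩ := exists_eq_zetaL (hN.image (psi c))
    obtain ⟨P, hP, hP1, rfl⟩ := (hrow Q).mp ⟨hQ, hQ1⟩
    rw [← hQ0, psi_apply_zero]
    have := zetaL_le hP hP1
    have := hNc P hP
    omega

/-- `δ′ + c = min_{P ∈ N} (P₀ + 2 P₁)` — the new `δ` is read on the weight `(1, 2)` of the source. -/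
theorem deltaL_image_psiC_add (hNc : ∀ P ∈ N, c ≤ P 0 + P 1) (hN : N.Nonempty) :
    deltaL (psi c '' N) + c = sInf ((fun P : Fin 2 →₀ ℕ => P 0 + 2 * P 1) '' N) := by
  apply le_antisymm
  · obtain ⟨P, hP, hPw⟩ := Nat.sInf_mem (hN.image (fun P : Fin 2 →₀ ℕ => P 0 + 2 * P 1))
    have hPw' : P 0 + 2 * P 1 = sInf ((fun P : Fin 2 →₀ ℕ => P 0 + 2 * P 1) '' N) := hPw
    have h := deltaL_le (N := psi c '' N) ⟨P, hP, rfl⟩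
    rw [psi_apply_zero, psi_apply_one] at h
    have := hNc P hP
    omega
  · obtain ⟨Q, ⟨P, hP, rfl⟩, hQd⟩ := exists_eq_deltaL (hN.image (psi c))
    rw [← hQd, psi_apply_zero, psi_apply_one]
    have h : sInf ((fun P : Fin 2 →₀ ℕ => P 0 + 2 * P 1) '' N) ≤ P 0 + 2 * P 1 := Nat.sInf_le ⟨P, hP, rfl⟩
    have := hNc P hP
    omega

/-- Every point of the image remembers the degree of its source: `Q₀ + c = P₀ + P₁`, `Q₁ = P₁`. -/
theorem exists_of_mem_image_psiC (hNc : ∀ P ∈ N, c ≤ P 0 + P 1) {Q : Fin 2 →₀ ℕ} (hQ : Q ∈ psi c '' N) :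
    ∃ P ∈ N, Q 0 + c = P 0 + P 1 ∧ Q 1 = P 1 := by
  obtain ⟨P, hP, rfl⟩ := hQ
  refine ⟨P, hP, ?_, psi_apply_one c P⟩
  rw [psi_apply_zero]
  have := hNc P hP
  omega

/-! ## The `u₂`-chart at scale `c`: `N′ = phiE c '' N` (the letter swap of `psi c`) -/

/-- `α′ = α`. -/
theorem alphaL_image_phiEC (c : ℕ) (N : Set (Fin 2 →₀ ℕ)) : alphaL (phiE c '' N) = alphaL N := by
  unfold alphaL
  congr 1
  ext n
  constructor
  · rintro ⟨Q, ⟨P, hP, rfl⟩, rfl⟩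
    exact ⟨P, hP, (phiE_apply_zero c P).symm⟩
  · rintro ⟨P, hP, rfl⟩
    exact ⟨phiE c P, ⟨P, hP, rfl⟩, phiE_apply_zero c P⟩

/-- `β′ = α + β − c` (CJS 12.2 (3) / 13.4 (2) at scale `c`). -/
theorem betaL_image_phiEC (hNc : ∀ P ∈ N, c ≤ P 0 + P 1) (hN : N.Nonempty) :
    betaL (phiE c '' N) = alphaL N + betaL N - c := by
  have hcol : ∀ Q, (Q ∈ phiE c '' N ∧ Q 0 = alphaL (phiE c '' N)) ↔ ∃ P ∈ N, P 0 = alphaL N ∧ Q = phiE c P := by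
    intro Q
    rw [alphaL_image_phiEC]
    constructor
    · rintro ⟨⟨P, hP, rfl⟩, h0⟩
      rw [phiE_apply_zero] at h0
      exact ⟨P, hP, h0, rfl⟩
    · rintro ⟨P, hP, hP0, rfl⟩
      exact ⟨⟨P, hP, rfl⟩, by rw [phiE_apply_zero]; exact hP0⟩
  apply le_antisymm
  · obtain ⟨P, hP, hP0, hP1⟩ := exists_eq_betaL hN
    have h := betaL_le (N := phiE c '' N) (P := phiE c P) ⟨P, hP, rfl⟩ (by rw [phiE_apply_zero, alphaL_image_phiEC]; exact hP0)
    rw [phiE_apply_one] at h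
    omega
  · obtain ⟨Q, hQ, hQ0, hQ1⟩ := exists_eq_betaL (hN.image (phiE c))
    obtain ⟨P, hP, hP0, rfl⟩ := (hcol Q).mp ⟨hQ, hQ0⟩
    rw [← hQ1, phiE_apply_one]
    have := betaL_le hP hP0
    have := hNc P hP
    omega

/-- `ε′ = δ − c`. -/
theorem epsL_image_phiEC (c : ℕ) (hN : N.Nonempty) : epsL (phiE c '' N) = deltaL N - c := by
  apply le_antisymm
  · obtain ⟨P, hP, hPd⟩ := exists_eq_deltaL hN
    have h := epsL_le (N := phiE c '' N) ⟨P, hP, rfl⟩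
    rw [phiE_apply_one] at h
    omega
  · obtain ⟨Q, ⟨P, hP, rfl⟩, hQ1⟩ := exists_eq_epsL (hN.image (phiE c))
    rw [← hQ1, phiE_apply_one]
    have := deltaL_le hP
    omega

/-- `δ′ + c = min_{P ∈ N} (2 P₀ + P₁)`. -/
theorem deltaL_image_phiEC_add (hNc : ∀ P ∈ N, c ≤ P 0 + P 1) (hN : N.Nonempty) :
    deltaL (phiE c '' N) + c = sInf ((fun P : Fin 2 →₀ ℕ => 2 * P 0 + P 1) '' N) := by
  apply le_antisymm
  · obtain ⟨P, hP, hPw⟩ := Nat.sInf_mem (hN.image (fun P : Fin 2 →₀ ℕ => 2 * P 0 + P 1))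
    have hPw' : 2 * P 0 + P 1 = sInf ((fun P : Fin 2 →₀ ℕ => 2 * P 0 + P 1) '' N) := hPw
    have h := deltaL_le (N := phiE c '' N) ⟨P, hP, rfl⟩
    rw [phiE_apply_zero, phiE_apply_one] at h
    have := hNc P hP
    omega
  · obtain ⟨Q, ⟨P, hP, rfl⟩, hQd⟩ := exists_eq_deltaL (hN.image (phiE c))
    rw [← hQd, phiE_apply_zero, phiE_apply_one]
    have h : sInf ((fun P : Fin 2 →₀ ℕ => 2 * P 0 + P 1) '' N) ≤ 2 * P 0 + P 1 := Nat.sInf_le ⟨P, hP, rfl⟩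
    have := hNc P hP
    omega

/-! ## Curve blow-ups: coordinate shifts by `c` (def-free: any map with the stated coordinate behaviour on `N`) -/

section ShiftFirst

variable {σ : (Fin 2 →₀ ℕ) → (Fin 2 →₀ ℕ)} (h0 : ∀ P ∈ N, σ P 0 + c = P 0) (h1 : ∀ P ∈ N, σ P 1 = P 1)
include h0 h1

omit h1 in
/-- Shift of the first coordinate by `c`: `α′ + c = α`. -/
theorem alphaL_image_shift_add (hN : N.Nonempty) : alphaL (σ '' N) + c = alphaL N := by
  apply le_antisymm
  · obtain ⟨P, hP, hP0⟩ := exists_eq_alphaL hN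
    have h := alphaL_le (N := σ '' N) ⟨P, hP, rfl⟩
    have := h0 P hP
    omega
  · obtain ⟨Q, ⟨P, hP, rfl⟩, hQ0⟩ := exists_eq_alphaL (hN.image σ)
    rw [← hQ0]
    have := alphaL_le hP
    have := h0 P hP
    omega

omit h0 in
/-- … `ε′ = ε`. -/
theorem epsL_image_shift (hN : N.Nonempty) : epsL (σ '' N) = epsL N := by
  apply le_antisymm
  · obtain ⟨P, hP, hP1⟩ := exists_eq_epsL hN
    have h := epsL_le (N := σ '' N) ⟨P, hP, rfl⟩
    rw [h1 P hP] at h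
    omega
  · obtain ⟨Q, ⟨P, hP, rfl⟩, hQ1⟩ := exists_eq_epsL (hN.image σ)
    rw [← hQ1, h1 P hP]
    exact epsL_le hP

/-- … `β′ = β`. -/
theorem betaL_image_shift (hN : N.Nonempty) : betaL (σ '' N) = betaL N := by
  have hα := alphaL_image_shift_add h0 hN
  have hcol : ∀ P ∈ N, (σ P 0 = alphaL (σ '' N) ↔ P 0 = alphaL N) := by
    intro P hP
    have := h0 P hP
    omega
  apply le_antisymm
  · obtain ⟨P, hP, hP0, hP1⟩ := exists_eq_betaL hN
    have h := betaL_le (N := σ '' N) (P := σ P) ⟨P, hP, rfl⟩ ((hcol P hP).mpr hP0)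
    rw [h1 P hP] at h
    omega
  · obtain ⟨Q, ⟨P, hP, rfl⟩, hQ0, hQ1⟩ := exists_eq_betaL (hN.image σ)
    rw [← hQ1, h1 P hP]
    exact betaL_le hP ((hcol P hP).mp hQ0)

/-- … `ζ′ + c = ζ`. -/
theorem zetaL_image_shift_add (hN : N.Nonempty) : zetaL (σ '' N) + c = zetaL N := by
  have hε := epsL_image_shift h1 hN
  have hrow : ∀ P ∈ N, (σ P 1 = epsL (σ '' N) ↔ P 1 = epsL N) := by
    intro P hP
    rw [h1 P hP, hε]
  apply le_antisymm
  · obtain ⟨P, hP, hP1, hP0⟩ := exists_eq_zetaL hN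
    have h := zetaL_le (N := σ '' N) (P := σ P) ⟨P, hP, rfl⟩ ((hrow P hP).mpr hP1)
    have := h0 P hP
    omega
  · obtain ⟨Q, ⟨P, hP, rfl⟩, hQ1, hQ0⟩ := exists_eq_zetaL (hN.image σ)
    rw [← hQ0]
    have := zetaL_le hP ((hrow P hP).mp hQ1)
    have := h0 P hP
    omega

/-- … `δ′ + c = δ`. -/
theorem deltaL_image_shift_add (hN : N.Nonempty) : deltaL (σ '' N) + c = deltaL N := by
  apply le_antisymm
  · obtain ⟨P, hP, hPd⟩ := exists_eq_deltaL hN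
    have h := deltaL_le (N := σ '' N) ⟨P, hP, rfl⟩
    have := h0 P hP
    have := h1 P hP
    omega
  · obtain ⟨Q, ⟨P, hP, rfl⟩, hQd⟩ := exists_eq_deltaL (hN.image σ)
    rw [← hQd]
    have := deltaL_le hP
    have := h0 P hP
    have := h1 P hP
    omega

end ShiftFirst

section ShiftSecond

variable {σ : (Fin 2 →₀ ℕ) → (Fin 2 →₀ ℕ)} (h0 : ∀ P ∈ N, σ P 0 = P 0) (h1 : ∀ P ∈ N, σ P 1 + c = P 1)
include h0 h1

omit h1 in
/-- Shift of the second coordinate by `c`: `α′ = α`. -/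
theorem alphaL_image_shift₂ (hN : N.Nonempty) : alphaL (σ '' N) = alphaL N := by
  apply le_antisymm
  · obtain ⟨P, hP, hP0⟩ := exists_eq_alphaL hN
    have h := alphaL_le (N := σ '' N) ⟨P, hP, rfl⟩
    rw [h0 P hP] at h
    omega
  · obtain ⟨Q, ⟨P, hP, rfl⟩, hQ0⟩ := exists_eq_alphaL (hN.image σ)
    rw [← hQ0, h0 P hP]
    exact alphaL_le hP

/-- … `β′ + c = β`. -/
theorem betaL_image_shift₂_add (hN : N.Nonempty) : betaL (σ '' N) + c = betaL N := by
  have hα := alphaL_image_shift₂ h0 hN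
  have hcol : ∀ P ∈ N, (σ P 0 = alphaL (σ '' N) ↔ P 0 = alphaL N) := by
    intro P hP
    rw [h0 P hP, hα]
  apply le_antisymm
  · obtain ⟨P, hP, hP0, hP1⟩ := exists_eq_betaL hN
    have h := betaL_le (N := σ '' N) (P := σ P) ⟨P, hP, rfl⟩ ((hcol P hP).mpr hP0)
    have := h1 P hP
    omega
  · obtain ⟨Q, ⟨P, hP, rfl⟩, hQ0, hQ1⟩ := exists_eq_betaL (hN.image σ)
    rw [← hQ1]
    have := betaL_le hP ((hcol P hP).mp hQ0)
    have := h1 P hP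
    omega

omit h0 in
/-- … `ε′ + c = ε`. -/
theorem epsL_image_shift₂_add (hN : N.Nonempty) : epsL (σ '' N) + c = epsL N := by
  apply le_antisymm
  · obtain ⟨P, hP, hP1⟩ := exists_eq_epsL hN
    have h := epsL_le (N := σ '' N) ⟨P, hP, rfl⟩
    have := h1 P hP
    omega
  · obtain ⟨Q, ⟨P, hP, rfl⟩, hQ1⟩ := exists_eq_epsL (hN.image σ)
    rw [← hQ1]
    have := epsL_le hP
    have := h1 P hP
    omega

/-- … `ζ′ = ζ`. -/
theorem zetaL_image_shift₂ (hN : N.Nonempty) : zetaL (σ '' N) = zetaL N := by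
  have hε := epsL_image_shift₂_add h1 hN
  have hrow : ∀ P ∈ N, (σ P 1 = epsL (σ '' N) ↔ P 1 = epsL N) := by
    intro P hP
    have := h1 P hP
    omega
  apply le_antisymm
  · obtain ⟨P, hP, hP1, hP0⟩ := exists_eq_zetaL hN
    have h := zetaL_le (N := σ '' N) (P := σ P) ⟨P, hP, rfl⟩ ((hrow P hP).mpr hP1)
    rw [h0 P hP] at h
    omega
  · obtain ⟨Q, ⟨P, hP, rfl⟩, hQ1, hQ0⟩ := exists_eq_zetaL (hN.image σ)
    rw [← hQ0, h0 P hP]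
    exact zetaL_le hP ((hrow P hP).mp hQ1)

/-- … `δ′ + c = δ`. -/
theorem deltaL_image_shift₂_add (hN : N.Nonempty) : deltaL (σ '' N) + c = deltaL N := by
  apply le_antisymm
  · obtain ⟨P, hP, hPd⟩ := exists_eq_deltaL hN
    have h := deltaL_le (N := σ '' N) ⟨P, hP, rfl⟩
    have := h0 P hP
    have := h1 P hP
    omega
  · obtain ⟨Q, ⟨P, hP, rfl⟩, hQd⟩ := exists_eq_deltaL (hN.image σ)
    rw [← hQd]
    have := deltaL_le hP
    have := h0 P hP
    have := h1 P hP
    omega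

end ShiftSecond

/-! ## Sanity: the `c = 2` laws of `…MonicDescentInvariantLaws` are the special case -/

/-- `alphaL_image_psi` is `alphaL_image_psiC 2`. -/
example (hN : N.Nonempty) : alphaL (psi 2 '' N) = deltaL N - 2 := alphaL_image_psiC 2 hN

/-- `betaL_image_phi` is `betaL_image_phiEC` at `c = 2` (via `phiE_two_eq_phi`). -/
example (hN2 : ∀ P ∈ N, 2 ≤ P 0 + P 1) (hN : N.Nonempty) : betaL (phiE 2 '' N) = alphaL N + betaL N - 2 :=
  betaL_image_phiEC hN2 hN

end MonicDescent

end Summit.ResolutionOfSingularities.ResolutionOfSingularities.Theorems
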